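import Literature.AlgebraicGeometry.Frobenioids.ModelFrobenioidFunctor
import Literature.AlgebraicGeometry.Frobenioids.PreFrobenioidMorphisms
import HarnessLib

/-!
# Frobenioids I, §5: the model Frobenioid is of Frobenius-normalized type

Mochizuki, *The geometry of Frobenioids I: the general theory*, Kyushu J. Math. **62** (2008),
Def. 1.2 (iv) (kurims p. 23: `A` is *Frobenius-normalized* if `α^d ∘ φ = φ ∘ α` for every base-identity
endomorphism `φ` of Frobenius degree `d` and every `α ∈ O^▷(A)`) applied to the model Frobenioid
`C = ModelFrobenioid Φ B Div_B` of Thm. 5.2 (i) (p. 100) with its structure functor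
`ModelFrobenioid.toElem` [cite: MochizukiFrdI2008, Thm. 5.2(i) p.100]: every object `(A_D, α)` is
Frobenius-normalized, by the explicit composition law `(d, id, Div φ, u_φ) ∘ (1, id, Div α, u_α)
= (d, id, Div φ + d · Div α, u_φ + d · u_α) = (1, id, Div α, u_α)^d ∘ (d, id, Div φ, u_φ)`. This is
condition (c) "Frobenius-normalized type" of Def. 3.1 (i) standard type / Thm. 5.2 (iii), and
hypothesis (b) of Prop. 1.13 (iii) (slimness) used by [FrdII] Thm. 1.2 (iv). PROOF-ONLY; no definitions.
-/

namespace Literature.AlgebraicGeometry.Frobenioids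

namespace ModelFrobenioid

open CategoryTheory Opposite

universe w v u

variable {D : Type u} [Category.{v} D] {Φ B : Dᵒᵖ ⥤ CommMonCat.{w}} {DivB : B ⟶ monoidGp Φ}

/-- Components of the powers `α^n ∈ End(X)` of a base-identity linear endomorphism
`α = (1, id, Div α, u_α)`: `α^n = (1, id, n · Div α, n · u_α)`. [cite: MochizukiFrdI2008, Thm. 5.2(i) p.100] -/
theorem components_pow_of_baseIdentity_linear {X : ModelFrobenioid Φ B DivB} (α : End X)
    (hb : baseMap α = 𝟙 X.base) (hd : degFr α = 1) (n : ℕ) :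
    degFr (α ^ n) = 1 ∧ baseMap (α ^ n) = 𝟙 X.base ∧ div (α ^ n) = div α ^ n ∧
      unit (α ^ n) = unit α ^ n := by
  induction n with
  | zero =>
    rw [pow_zero, End.one_def, pow_zero, pow_zero]
    exact ⟨rfl, rfl, rfl, rfl⟩
  | succ n ih =>
    obtain ⟨h1, h2, h3, h4⟩ := ih
    rw [pow_succ, End.mul_def]
    refine ⟨?_, ?_, ?_, ?_⟩
    · rw [degFr_comp, h1, hd, mul_one]
    · rw [baseMap_comp, h2, hb, Category.comp_id]
    · rw [div_comp, hb, h3, h1, PNat.one_coe, pow_one, op_id, Φ.map_id, CommMonCat.hom_id,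
        MonoidHom.id_apply, pow_succ]
    · rw [unit_comp, hb, h4, h1, PNat.one_coe, pow_one, op_id, B.map_id, CommMonCat.hom_id,
        MonoidHom.id_apply, pow_succ]

/-- **Every object of the model Frobenioid is Frobenius-normalized** (Def. 1.2 (iv)): for a
base-identity endomorphism `φ = (d, id, Div φ, u_φ)` and `α = (1, id, Div α, u_α) ∈ O^▷`,
`φ ≫ α^d = α ≫ φ`, both sides being `(d, id, Div φ + d · Div α, u_φ + d · u_α)`.
[cite: MochizukiFrdI2008, Thm. 5.2(i) p.100] -/
theorem isFrobeniusNormalized (X : ModelFrobenioid Φ B DivB) :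
    PreFrobenioid.IsFrobeniusNormalized (toElem Φ B DivB) X := by
  intro φ hφ α hα
  have hφb : baseMap φ = 𝟙 X.base := hφ
  have hαb : baseMap (show X ⟶ X from α) = 𝟙 X.base := hα.1
  have hαd : degFr (show X ⟶ X from α) = 1 := hα.2
  obtain ⟨h1, h2, h3, h4⟩ := components_pow_of_baseIdentity_linear α hαb hαd (degFr φ : ℕ)
  change φ ≫ (show X ⟶ X from α ^ (degFr φ : ℕ)) = (show X ⟶ X from α) ≫ φ
  apply hom_ext
  · change degFr (α ^ (degFr φ : ℕ)) * degFr φ = degFr φ * degFr α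
    rw [h1, hαd, one_mul, mul_one]
  · change baseMap φ ≫ baseMap (α ^ (degFr φ : ℕ)) = baseMap α ≫ baseMap φ
    rw [h2, hαb, hφb]
  · change (Φ.map (baseMap φ).op).hom (div (α ^ (degFr φ : ℕ))) * div φ ^ (degFr (α ^ (degFr φ : ℕ)) : ℕ)
        = (Φ.map (baseMap α).op).hom (div φ) * div α ^ (degFr φ : ℕ)
    rw [hφb, hαb, op_id, Φ.map_id, CommMonCat.hom_id, MonoidHom.id_apply, MonoidHom.id_apply, h3,
      h1, PNat.one_coe, pow_one, mul_comm]
  · change (B.map (baseMap φ).op).hom (unit (α ^ (degFr φ : ℕ))) * unit φ ^ (degFr (α ^ (degFr φ : ℕ)) : ℕ)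
        = (B.map (baseMap α).op).hom (unit φ) * unit α ^ (degFr φ : ℕ)
    rw [hφb, hαb, op_id, B.map_id, CommMonCat.hom_id, MonoidHom.id_apply, MonoidHom.id_apply, h4,
      h1, PNat.one_coe, pow_one, mul_comm]

/-- The model Frobenioid is **of Frobenius-normalized type** (Def. 1.2 (iv)/(v); condition (c) of
"standard type", Def. 3.1 (i), as needed in Thm. 5.2 (iii)). [cite: MochizukiFrdI2008, Thm. 5.2(iii) p.101] -/
theorem isOfType_isFrobeniusNormalized :
    PreFrobenioid.IsOfType (PreFrobenioid.IsFrobeniusNormalized (toElem Φ B DivB)) :=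
  fun X => isFrobeniusNormalized X

end ModelFrobenioid

end Literature.AlgebraicGeometry.Frobenioids
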